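import Summits.RiemannHypothesis.RiemannHypothesis.Theorems.Splittings.JensenX4NewmanDict
import Summits.RiemannHypothesis.RiemannHypothesis.Theses.LaguerreSpeiserSplit
import HarnessLib

/-!
# DICTIONARY: X-4 / C1's conjunct `A = RowsFromOne` ⟺ the ledger crux `XiPrimeOnLine` of route `LaguerreSpeiserSplit`
# ⟺ «every zero of `ξ′(s)` lies on `Re s = ½`» (Levinson–Montgomery–Conrey's `RH₁`) — zero-def bookkeeping

Cell rh-split, seat rh-splitx-theory-1 g3 (batch 4 §13.4/13.6; file `T13RowsFromOneXiPrime.lean` sha16 f31201c0ab6d973e), placed by lead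
rh-split-lead g3 RULING #33 as a NEW Theorems/Splittings file (NOT an append to `JensenX4NewmanDict`); filed by rh-split-typer-1 g4 after the
referee's replay/content word.  Verbatim decls; namespace `Scratch.SplitxTheory1G3` ↦ `Theorems.Splittings.JensenX4RowsFromOneXiPrime`.
HONEST LABEL: «SPLITTING SEARCH over kernel-typed RH-EQUIVALENCES; a splitting A ∧ B ⟹ RH is CONDITIONAL
bookkeeping unless A and B are both proved; nothing here bears on the truth of RH.»

Zero definitions, zero `sorry`. Everything is a change of variables on top of the tree:
`rowsFromOne_iff_xiRowHyperbolic_one` (JensenDerivativeLadder), `xiRowHyperbolic_iff_xiDerivZerosReal`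
(XiJensenRows), `riemannXi_eq_xiSq` (`ξ(s) = ξ₁((s − ½)²)`), `re_neg_of_iteratedDeriv_xiSq_eq_zero_of_im_eq_zero`
(real zeros of `ξ₁⁽ⁿ⁾` are negative: positivity of the Taylor coefficients), exactly as in the jen-neg g4
dictionary `rowsFromOne_iff_hasOnlyRealZeros_deriv_deBruijnH_zero` (de Bruijn's variable `H₀(z) = ξ(½ + iz/2)/8`);
here the variable is Riemann's `Ξ(z) = ξ(½ + iz)` (`riemannXiUpper`), in which the route's crux is typed.
-/

set_option linter.dupNamespace false

noncomputable section

open Complex Polynomial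

namespace Summit.RiemannHypothesis.RiemannHypothesis.Theorems.Splittings.JensenX4RowsFromOneXiPrime

open Literature Literature.NumberTheory.LFunctions
open Summit.RiemannHypothesis.RiemannHypothesis.Theorems.Splittings.JensenDerivativeLadder
open Summit.RiemannHypothesis.RiemannHypothesis.Theorems.Splittings.JensenX4NewmanDict
open Summit.RiemannHypothesis.RiemannHypothesis.Theses.LaguerreSpeiserSplit (XiPrimeOnLine)

/-- `Ξ(z) = ξ(½ + i z) = ξ₁(−z²)`. -/
theorem riemannXiUpper_eq_xiSq (z : ℂ) : riemannXiUpper z = xiSq (-(z ^ 2)) := by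
  rw [riemannXiUpper, riemannXi_eq_xiSq]
  have e : (1 / 2 + I * z - 1 / 2 : ℂ) ^ 2 = -(z ^ 2) := by
    have : (1 / 2 + I * z - 1 / 2 : ℂ) = I * z := by ring
    rw [this, mul_pow, I_sq]; ring
  rw [e]

/-- `Ξ′(z) = −2z · ξ₁′(−z²)`. -/
theorem deriv_riemannXiUpper (z : ℂ) :
    deriv riemannXiUpper z = -(2 * z) * deriv xiSq (-(z ^ 2)) := by
  have hΞ : riemannXiUpper = fun w ↦ xiSq (-(w ^ 2)) := funext riemannXiUpper_eq_xiSq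
  rw [hΞ]
  have hin : HasDerivAt (fun w : ℂ ↦ -(w ^ 2)) (-((2 : ℕ) * z ^ (2 - 1))) z :=
    (hasDerivAt_pow 2 z).neg
  have hx : HasDerivAt xiSq (deriv xiSq (-(z ^ 2))) (-(z ^ 2)) :=
    (differentiable_xiSq.differentiableAt).hasDerivAt
  have h := hx.comp z hin
  rw [show (fun w : ℂ ↦ xiSq (-(w ^ 2))) = (xiSq ∘ fun w : ℂ ↦ -(w ^ 2)) from rfl, h.deriv]
  simp only [Nat.cast_ofNat]
  ring

/-- **`XiPrimeOnLine ⟺ Z₁ = ∅`**: every zero of `Ξ′` is real iff every zero of `ξ₁′` is real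
(the real zeros of `ξ₁′` being automatically negative). -/
theorem xiPrimeOnLine_iff_xiDerivZerosReal_one : XiPrimeOnLine ↔ XiDerivZerosReal 1 := by
  simp only [XiPrimeOnLine, XiDerivZerosReal, iteratedDeriv_one, deriv_riemannXiUpper]
  constructor
  · intro h w hw
    have hroot : (w ^ (2⁻¹ : ℂ)) ^ 2 = w := by exact_mod_cast Complex.cpow_nat_inv_pow w two_ne_zero
    set z : ℂ := I * w ^ (2⁻¹ : ℂ) with hz
    have hz2 : -(z ^ 2) = w := by rw [hz, mul_pow, I_sq, hroot]; ring
    have hzim : z.im = 0 := h z (by rw [hz2, hw, mul_zero])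
    rw [← hz2]
    simp [sq, Complex.mul_im, hzim]
  · intro h z hz
    rcases mul_eq_zero.1 hz with h1 | h2
    · have : z = 0 := by simpa using h1
      simp [this]
    · have him := h _ h2
      have hre := re_neg_of_iteratedDeriv_xiSq_eq_zero_of_im_eq_zero 1
        (by rwa [iteratedDeriv_one]) him
      simp only [Complex.neg_im, Complex.neg_re, sq, Complex.mul_im, Complex.mul_re] at him hre
      have hprod : z.re * z.im = 0 := by linarith
      rcases mul_eq_zero.1 hprod with h0 | h0
      · exfalso
        rw [h0] at hre
        nlinarith [sq_nonneg z.im]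
      · exact h0

/-- **KERNEL DICTIONARY (cell rh-split ↔ ledger route).** X-4 / C1's conjunct `A = RowsFromOne`
(every Jensen polynomial of `ξ` of every row `n ≥ 1` is hyperbolic) is EQUIVALENT to the deciding
crux `XiPrimeOnLine` of route `LaguerreSpeiserSplit` (every zero of `Ξ′` is real). -/
theorem rowsFromOne_iff_xiPrimeOnLine :
    (∀ d n : ℕ, 1 ≤ n → (jensenPoly xiTaylorCoeff d n).Splits) ↔ XiPrimeOnLine := by
  rw [rowsFromOne_iff_xiRowHyperbolic_one, xiRowHyperbolic_iff_xiDerivZerosReal,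
    xiPrimeOnLine_iff_xiDerivZerosReal_one]

/-- `Ξ′(z) = i · ξ′(½ + i z)`.
(private: the same statement is LANDED as `Literature.NumberTheory.LFunctions.deriv_riemannXiUpper` in
`CardonRobertsOrthogonalPolynomials.lean` — gate dedup; kept local to avoid that module's import cone.) -/
private theorem deriv_riemannXiUpper_eq_deriv_riemannXi (z : ℂ) :
    deriv riemannXiUpper z = I * deriv riemannXi (1 / 2 + I * z) := by
  have hin : HasDerivAt (fun w : ℂ ↦ (1 / 2 : ℂ) + I * w) (I * 1) z :=
    ((hasDerivAt_id z).const_mul I).const_add (1 / 2 : ℂ)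
  have hx : HasDerivAt riemannXi (deriv riemannXi (1 / 2 + I * z)) (1 / 2 + I * z) :=
    (differentiable_riemannXi.differentiableAt).hasDerivAt
  have h := hx.comp z hin
  have hfun : (riemannXi ∘ fun w : ℂ ↦ (1 / 2 : ℂ) + I * w) = riemannXiUpper := rfl
  rw [hfun] at h
  rw [h.deriv]
  ring

/-- **`XiPrimeOnLine ⟺ RH₁`**: every zero of `Ξ′` is real iff every zero of `ξ′(s)` has `Re s = ½`
(the object of Levinson–Montgomery 1974 and Conrey 1983: `≥ 81.37 %` of the zeros of `ξ′` are on the line). -/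
theorem xiPrimeOnLine_iff_deriv_riemannXi_re :
    XiPrimeOnLine ↔ ∀ s : ℂ, deriv riemannXi s = 0 → s.re = 1 / 2 := by
  constructor
  · intro h s hs
    set z : ℂ := -I * (s - 1 / 2) with hz
    have hsz : (1 / 2 : ℂ) + I * z = s := by rw [hz]; ring_nf; rw [I_sq]; ring
    have hΞ : deriv riemannXiUpper z = 0 := by
      rw [deriv_riemannXiUpper_eq_deriv_riemannXi, hsz, hs, mul_zero]
    have hzim : z.im = 0 := h z hΞ
    have : z.im = -(s.re - 1 / 2) := by
      rw [hz]; simp [Complex.mul_im]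
    linarith
  · intro h z hz
    have hs : deriv riemannXi (1 / 2 + I * z) = 0 := by
      have := deriv_riemannXiUpper_eq_deriv_riemannXi z
      rw [hz] at this
      rcases mul_eq_zero.1 this.symm with hI | hd
      · exact absurd hI I_ne_zero
      · exact hd
    have hre := h _ hs
    have : ((1 / 2 : ℂ) + I * z).re = 1 / 2 - z.im := by
      simp [Complex.mul_re, sub_eq_add_neg]
    linarith

/-- **C1's `A` ⟺ `RH₁`** (the three together). -/
theorem rowsFromOne_iff_deriv_riemannXi_re :
    (∀ d n : ℕ, 1 ≤ n → (jensenPoly xiTaylorCoeff d n).Splits) ↔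
      ∀ s : ℂ, deriv riemannXi s = 0 → s.re = 1 / 2 :=
  rowsFromOne_iff_xiPrimeOnLine.trans xiPrimeOnLine_iff_deriv_riemannXi_re

end Summit.RiemannHypothesis.RiemannHypothesis.Theorems.Splittings.JensenX4RowsFromOneXiPrime

end
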